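import Mathlib.Analysis.SpecialFunctions.Arsinh
import Literature.Probability.RandomPlanarGeometry.EllipticKAGM
import HarnessLib

/-!
# The logarithmic upper bound `K(u) ≤ ½ log(1/(1-u)) + 2 log(1+√2)` for the complete elliptic integral

Topic `Literature/Analysis/SpecialFunctions`. Companion of the LOWER bound `log_le_ellipticK`
(`Literature/Probability/RandomPlanarGeometry/EllipticKBasic.lean`: `½ log((3-u)/(1-u)) ≤ K(u)`): through
the tree's representation `K(1 - b²) = ∫_{(0,∞)} dx/√((x²+1)(x²+b²))` (`integral_Ioi_agm_eq_ellipticK`,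
`gaussAGMIntegral_eq_ellipticK`) the complementary modulus `k′ = √(1-u)` controls `K` logarithmically:
splitting at `x = 1` and dropping one factor on each piece,
`∫₀¹ dx/√(x²+k′²) = arsinh(1/k′) ≤ log((1+√2)/k′)` and `∫₁^∞ dx/(x√(x²+1)) = arsinh 1 = log(1+√2)`, so

* `ellipticK_le_log` — **`K(u) ≤ log(1/√(1-u)) + 2 log(1+√2)`** for `0 ≤ u < 1`

(the elementary estimate of the cell note CERT-SREP §2, gate-hubbard-kl; the sharp constant is `log 4`:
`K(k) = log(4/k′) + O(k′² log k′)`, Borwein–Borwein (1.3.10), not needed here). Used to bound the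
van Hove logarithm of the square-lattice density of states `ρ = K(m)/(2π²√(ab))` as `m → 1`.

## References
* [BorweinBorwein1987] J. M. Borwein, P. B. Borwein, *Pi and the AGM*, Wiley (1987), §1.3, (1.3.10).
* Cell note CERT-SREP §2 (gate-hubbard-kl, 2026), inequality (B2).
-/

noncomputable section

open Real _root_.MeasureTheory _root_.Set _root_.Filter
open scoped _root_.Topology
open Literature.Probability.RandomPlanarGeometry

namespace Literature.Analysis.SpecialFunctions

/-- `arsinh x ≤ log((1+√2) x)` for `x ≥ 1`. [folklore] -/
private theorem arsinh_le_log {x : ℝ} (hx : 1 ≤ x) : Real.arsinh x ≤ Real.log ((1 + Real.sqrt 2) * x) := by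
  have hx0 : 0 < x := by linarith
  rw [Real.arsinh]
  apply Real.log_le_log (by positivity)
  have h2 : Real.sqrt (1 + x ^ 2) ≤ Real.sqrt 2 * x := by
    rw [show Real.sqrt 2 * x = Real.sqrt (2 * x ^ 2) by
      rw [Real.sqrt_mul (by norm_num), Real.sqrt_sq hx0.le]]
    exact Real.sqrt_le_sqrt (by nlinarith)
  linarith

/-- `arsinh 1 = log(1+√2)`. [folklore] -/
private theorem arsinh_one : Real.arsinh 1 = Real.log (1 + Real.sqrt 2) := by
  rw [Real.arsinh]; norm_num

/-- `∫₀¹ dx/√(x²+b²) = arsinh(1/b)` for `b > 0`. [folklore] -/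
private theorem integral_inv_sqrt_sq_add_sq {b : ℝ} (hb : 0 < b) :
    ∫ x in (0 : ℝ)..1, 1 / Real.sqrt (x ^ 2 + b ^ 2) = Real.arsinh (1 / b) := by
  have hderiv : ∀ x ∈ uIcc (0 : ℝ) 1, HasDerivAt (fun x : ℝ => Real.arsinh (x / b)) (1 / Real.sqrt (x ^ 2 + b ^ 2)) x := by
    intro x _
    have h := ((hasDerivAt_id' x).div_const b).arsinh
    convert h using 1
    rw [smul_eq_mul]
    have hb2 : Real.sqrt (x ^ 2 + b ^ 2) = b * Real.sqrt (1 + (x / b) ^ 2) := by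
      rw [show x ^ 2 + b ^ 2 = b ^ 2 * (1 + (x / b) ^ 2) by field_simp; ring,
        Real.sqrt_mul (by positivity), Real.sqrt_sq hb.le]
    rw [hb2]
    have := (Real.sqrt_pos.2 (by positivity : (0:ℝ) < 1 + (x / b) ^ 2)).ne'
    field_simp
  have hcont : ContinuousOn (fun x : ℝ => 1 / Real.sqrt (x ^ 2 + b ^ 2)) (uIcc (0 : ℝ) 1) := by
    apply ContinuousOn.div continuousOn_const
    · exact (continuousOn_id.pow 2 |>.add continuousOn_const).sqrt
    · intro x _; exact (Real.sqrt_pos.2 (by positivity)).ne'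
  rw [intervalIntegral.integral_eq_sub_of_hasDerivAt hderiv (hcont.intervalIntegrable)]
  simp [Real.arsinh_zero]

/-- `∫₁^∞ dx/(x√(x²+1)) = arsinh 1`, with integrability. [folklore] -/
private theorem integral_Ioi_inv_mul_sqrt :
    IntegrableOn (fun x : ℝ => 1 / (x * Real.sqrt (x ^ 2 + 1))) (Ioi (1 : ℝ)) ∧
    ∫ x in Ioi (1 : ℝ), 1 / (x * Real.sqrt (x ^ 2 + 1)) = Real.arsinh 1 := by
  -- antiderivative `F(x) = -arsinh(x⁻¹)`, `F(x) → 0` at `∞`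
  have hderiv : ∀ x ∈ Ioi (1 : ℝ), HasDerivAt (fun x : ℝ => -Real.arsinh x⁻¹) (1 / (x * Real.sqrt (x ^ 2 + 1))) x := by
    intro x hx
    have hx0 : 0 < x := by linarith [mem_Ioi.1 hx]
    have h0 := (hasDerivAt_inv hx0.ne').arsinh
    have h : HasDerivAt (fun y : ℝ => -Real.arsinh y⁻¹) (-((Real.sqrt (1 + x⁻¹ ^ 2))⁻¹ • -(x ^ 2)⁻¹)) x :=
      h0.neg
    convert h using 1
    rw [smul_eq_mul]
    have hs : Real.sqrt (1 + (x⁻¹) ^ 2) = Real.sqrt (x ^ 2 + 1) / x := by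
      rw [show 1 + (x⁻¹) ^ 2 = (x ^ 2 + 1) / x ^ 2 by field_simp, Real.sqrt_div' _ (by positivity),
        Real.sqrt_sq hx0.le]
    rw [hs]
    have := (Real.sqrt_pos.2 (by positivity : (0:ℝ) < x ^ 2 + 1)).ne'
    field_simp
  have hcont : ContinuousWithinAt (fun x : ℝ => -Real.arsinh x⁻¹) (Ici (1 : ℝ)) 1 := by
    apply ContinuousAt.continuousWithinAt
    exact ((Real.continuous_arsinh.continuousAt).comp (continuousAt_inv₀ one_ne_zero)).neg
  have hlim : Tendsto (fun x : ℝ => -Real.arsinh x⁻¹) atTop (𝓝 0) := by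
    have h2 : Tendsto (fun x : ℝ => Real.arsinh x⁻¹) atTop (𝓝 0) := by
      have := (Real.continuous_arsinh.tendsto 0).comp tendsto_inv_atTop_zero
      simpa [Real.arsinh_zero, Function.comp_def] using this
    simpa using h2.neg
  have hpos : ∀ x ∈ Ioi (1 : ℝ), 0 ≤ 1 / (x * Real.sqrt (x ^ 2 + 1)) := fun x hx => by
    have : 0 < x := by linarith [mem_Ioi.1 hx]
    positivity
  refine ⟨integrableOn_Ioi_deriv_of_nonneg hcont hderiv hpos hlim, ?_⟩
  rw [integral_Ioi_of_hasDerivAt_of_nonneg hcont hderiv hpos hlim]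
  simp

/-- **Logarithmic upper bound for the complete elliptic integral of the first kind** (parameter
convention): for `0 ≤ u < 1`, `K(u) ≤ log(1/√(1-u)) + 2 log(1+√2)`
(CERT-SREP (B2): `K ≤ log(1/k′) + c_K`, `c_K = 2 log(1+√2) ≈ 1.7627`, `k′ = √(1-u)`; the sharp constant
would be `log 4`). [cite: BorweinBorwein1987, §1.3 (1.3.10)] -/
theorem ellipticK_le_log {u : ℝ} (hu0 : 0 ≤ u) (hu1 : u < 1) :
    ellipticK u ≤ Real.log (1 / Real.sqrt (1 - u)) + 2 * Real.log (1 + Real.sqrt 2) := by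
  set k : ℝ := Real.sqrt (1 - u) with hk
  have hk0 : 0 < k := Real.sqrt_pos.2 (by linarith)
  have hk1 : k ≤ 1 := by
    have := Real.sqrt_le_sqrt (show 1 - u ≤ 1 by linarith); rwa [Real.sqrt_one] at this
  have hksq : k ^ 2 = 1 - u := Real.sq_sqrt (by linarith)
  -- `K(u) = ∫_{(0,∞)} dx/√((x²+1)(x²+k²))`
  have hK : ellipticK u = ∫ x in Ioi (0 : ℝ), 1 / Real.sqrt ((x ^ 2 + 1 ^ 2) * (x ^ 2 + k ^ 2)) := by
    rw [integral_Ioi_agm_eq_ellipticK one_pos hk0, hksq]; norm_num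
  rw [hK]
  have hint := (integrable_gaussAGMIntegrand one_pos hk0)
  -- split at 1
  have hsplit : ∫ x in Ioi (0 : ℝ), 1 / Real.sqrt ((x ^ 2 + 1 ^ 2) * (x ^ 2 + k ^ 2)) =
      (∫ x in Ioc (0 : ℝ) 1, 1 / Real.sqrt ((x ^ 2 + 1 ^ 2) * (x ^ 2 + k ^ 2))) +
        ∫ x in Ioi (1 : ℝ), 1 / Real.sqrt ((x ^ 2 + 1 ^ 2) * (x ^ 2 + k ^ 2)) := by
    rw [← Ioc_union_Ioi_eq_Ioi zero_le_one, setIntegral_union (Ioc_disjoint_Ioi le_rfl) measurableSet_Ioi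
      hint.integrableOn hint.integrableOn]
  rw [hsplit]
  -- piece 1: `≤ arsinh(1/k) ≤ log((1+√2)/k)`
  have h1 : ∫ x in Ioc (0 : ℝ) 1, 1 / Real.sqrt ((x ^ 2 + 1 ^ 2) * (x ^ 2 + k ^ 2)) ≤ Real.log ((1 + Real.sqrt 2) * (1 / k)) := by
    have hcont2 : ContinuousOn (fun x : ℝ => 1 / Real.sqrt (x ^ 2 + k ^ 2)) (Icc (0 : ℝ) 1) := by
      apply ContinuousOn.div continuousOn_const
      · exact (continuousOn_id.pow 2 |>.add continuousOn_const).sqrt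
      · intro x _; exact (Real.sqrt_pos.2 (by positivity)).ne'
    have hle : ∫ x in Ioc (0 : ℝ) 1, 1 / Real.sqrt ((x ^ 2 + 1 ^ 2) * (x ^ 2 + k ^ 2)) ≤
        ∫ x in Ioc (0 : ℝ) 1, 1 / Real.sqrt (x ^ 2 + k ^ 2) := by
      refine setIntegral_mono_on hint.integrableOn
        ((hcont2.integrableOn_Icc).mono_set Ioc_subset_Icc_self) measurableSet_Ioc fun x hx => ?_
      apply one_div_le_one_div_of_le (Real.sqrt_pos.2 (by positivity))
      apply Real.sqrt_le_sqrt
      have : 0 ≤ x ^ 2 + k ^ 2 := by positivity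
      nlinarith
    refine hle.trans ?_
    rw [← intervalIntegral.integral_of_le zero_le_one, integral_inv_sqrt_sq_add_sq hk0]
    exact arsinh_le_log (by rw [le_div_iff₀ hk0]; linarith)
  -- piece 2: `≤ arsinh 1 = log(1+√2)`
  have h2 : ∫ x in Ioi (1 : ℝ), 1 / Real.sqrt ((x ^ 2 + 1 ^ 2) * (x ^ 2 + k ^ 2)) ≤ Real.log (1 + Real.sqrt 2) := by
    obtain ⟨hint2, hval2⟩ := integral_Ioi_inv_mul_sqrt
    have hle : ∫ x in Ioi (1 : ℝ), 1 / Real.sqrt ((x ^ 2 + 1 ^ 2) * (x ^ 2 + k ^ 2)) ≤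
        ∫ x in Ioi (1 : ℝ), 1 / (x * Real.sqrt (x ^ 2 + 1)) := by
      refine setIntegral_mono_on hint.integrableOn hint2 measurableSet_Ioi fun x hx => ?_
      have hx0 : 0 < x := by linarith [mem_Ioi.1 hx]
      apply one_div_le_one_div_of_le (by positivity)
      rw [show x * Real.sqrt (x ^ 2 + 1) = Real.sqrt (x ^ 2 * (x ^ 2 + 1 ^ 2)) by
        rw [Real.sqrt_mul (by positivity), Real.sqrt_sq hx0.le]; norm_num]
      apply Real.sqrt_le_sqrt
      rw [mul_comm]
      apply mul_le_mul_of_nonneg_left _ (by positivity)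
      nlinarith
    rw [hval2, arsinh_one] at hle
    exact hle
  -- assemble
  have hlog : Real.log ((1 + Real.sqrt 2) * (1 / k)) = Real.log (1 / k) + Real.log (1 + Real.sqrt 2) := by
    rw [mul_comm, Real.log_mul (by positivity) (by positivity)]
  rw [hlog] at h1
  linarith

end Literature.Analysis.SpecialFunctions
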